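import Summits.BirchSwinnertonDyer.BirchSwinnertonDyer.Theses.SignedLowerHalves
import Summits.BirchSwinnertonDyer.BirchSwinnertonDyer.Theorems.EisensteinPrimesHidaLimitFittingBoundConverse
import Literature.NumberTheory.EllipticCurves.CyclotomicIwasawaMainTheoremIrreducibleProofs
import Literature.NumberTheory.EllipticCurves.LeadingTermPPartProofs
import Literature.NumberTheory.EllipticCurves.Sprung2012.SharpFlatSelmerDualExistsProofs
import Literature.NumberTheory.EllipticCurves.CastellaCiperianiSkinnerSprung2018.NonordinaryPPartOPEN
import Literature.NumberTheory.EllipticCurves.FouquetWan2021.KatoMainConjecturePPartOPEN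
import HarnessLib

/-!
# Disproof of `SprungLowerDivisibilityAtThree` — findings (cdisprove seat, item stmt-BirchSwinnertonDyer-19875)

Crux (identical body in routes `SignedLowerHalves` / `PrintX8` / `PrintX8VS`):
`∀ W (X8: p = 3, good supersingular, a₃ ≠ 0) •, Theorems.SprungSharpFlatLowerDivisibility W 3 •` — the
Eisenstein (lower) half `ϖ·L^•_p(f) ∣ char_Λ X^•(E/ℚ_∞)` of Sprung's ♯/♭ main conjecture
(Sprung 2012 Main Conj. 1.3 / 7.21) at `(3, a₃ = ±3)`.

## Verdict: NO KILL. The statement is pinned (no junk instance) and equals the printed OPEN half-conjecture.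

Every binder of the leaf was checked for a junk / degenerate instantiation (details in NOTES.md §pinning):
* `κ, γ` — pinned by `IsCyclotomic`, `IsTopGenerator`, `IsCyclotomicVariable` (γ ↦ 1+T matches `mazurTateElement`);
* `v` — the unique place above `p`; `g` — any local lift: orbit sums depend on `γ^j` only;
* `(cneg, c)` — `IsHondaSystem` = Sprung 2012 Thm 2.2 incl. the generation / `p`-saturation clauses: `c ≡ 0` excluded;
* `f` — `IsNewformOf W f` = genuinely new, normalised eigenform with `a_n(f) = a_n(W)`: level = conductor, no old forms;
* `ϖ` — `ϖ·Ω_W = Ω⁺_f` with `Ω⁺_f = plusPeriod f` (cusp-symbol lattice; the `= 0` junk branch kills `θ_n`, hence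
  `L♯ = L♭ = 0` by uniqueness, hence the guard: vacuous, not false). KEY: `IsSprungPair` normalises `θ_n(f)` by the
  SAME `Ω⁺_f` (`ratPlusSymbol f r = Re ∫_r^{i∞} / Ω⁺_f`), so the product `ϖ · L^•` is INTRINSICALLY the
  Néron-normalised `L^•_E` of Sprung 2012 whatever `Ω⁺_f` is (Manin constant, cuspidal index and all): the
  conclusion `ι gen = ϖ · ι(L^• h)` is literally "`L^•_E ∣ char X^•`" — Main Conj. 7.21's `⊆`. No normalisation
  loophole in either direction (`v₃(ϖ) ≠ 0` cannot be played against the statement);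
* `(L♯, L♭)` — `IsSprungPair` = congruence to `θ_n(f)` mod `ω_n` for ALL `n` ⇒ unique (Sprung 2017 Thm 1.12; tree
  `Sprung2017/SharpFlatPAdicLFunctionUniqueProofs`), and inhabited (`thm112_exists_isSprungPair_holds`);
* `D` — `SharpFlatSelmerDualData`: `X ≅ Hom(Sel^•_∞, ℚ/ℤ)` with `T = conj_γ − 1` and constants pinned; any two data
  have isomorphic `X` (Krull), inhabited for every `γ` (`nonempty_sharpFlatSelmerDualData_rat`).
Hence `¬ crux` ⇔ an X8 curve with `char X^• ⊄ (L^•_E)`, i.e. a counterexample to Main Conj. 7.21 — not locatable: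
`X^•` is not computable, and Kato's direction (`thm716`, `gen ∣ 3ⁿ·L^•`) bounds the wrong way; the 217-cell X8
census (item evidence, refuter g2 2026-08-27) is numerically consistent (λ^• analytic = corank patterns).

## Kernel-checked load-bearing content of this file
1. `not_lowerShape_of_eq_zero`, `lowerDivisibility_conclusion_false_of_chromaticL_eq_zero` — the conclusion
   shape is UNSATISFIABLE at `L^• = 0` for every datum (`char ≠ ⊥`, `ι` injective): the guard `L^• ≠ 0` is
   load-bearing; `chromaticL_ne_zero_of_withoutGuard` — the guard-free variant
   `SprungSharpFlatLowerDivisibilityWithoutGuard` implies NON-VANISHING of `L^•` for every admissible data tuple,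
   i.e. Sprung 2017 Conj. 4.12 (OPEN: "L^♭_p, L^♯_p are not identically zero (a_p ≠ 2)") for the curve — so no
   `_false_without_guard` theorem is available either (it would refute Conj. 4.12).
2. `isTorsion_of_charIdeal_eq_span_of_constantCoeff_eq_zero`, `isTorsion_of_charIdeal_eq_span_of_not_isUnit`,
   `isTorsion_of_sprungLowerDivisibilityAtThree` — TORSION SMUGGLING: with the tree's junk convention
   `char(non-torsion) = ⊤` (`Theorems.charIdeal_eq_top_of_not_isTorsion`) the "lower half" as typed FORCES
   `X^•` to be `Λ`-torsion whenever `ϖ·L^•` is a non-unit (always in analytic rank ≥ 1, where `L^•(0) = c_• ·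
   L(E,1)/Ω = 0`). In print (char of a non-torsion module := 0) the lower half is trivially true there. Not a
   misstatement in substance — Sprung 2012 Thm 7.14 (Kato; typed fact `thm714_sharpFlatSelmerDual_finite_torsion`)
   discharges it — but ANY proof of the crux must import Thm 7.14: the crux is "Thm 7.14 ∧ Eisenstein half", not a
   pure lower bound.
3. Chromatic constants at X8 (`Sprung2017.chromaticConst 3 a •`: `c_♯ = −a²+2a+p−1`, `c_♭ = 2−a`):
   `a₃ = 3 ↦ (−1, −1)`, `a₃ = −3 ↦ (−13, 5)` — all `3`-adic UNITS (`example`s below by `decide`; tree lemma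
   `ClassX8.not_dvd_chromaticConst'`): neither colour has a forced trivial zero `L^•(0) = 0` in rank 0, so the
   guard never fails for trivial reasons and the smuggled torsion conjunct bites exactly when `3 ∣ L(E,1)/Ω⁺`
   or `L(E,1) = 0`.

## What print excludes (D-0131 class #6): EVERY X8 curve (typed in §(c): `AnnouncedLocusX8`, `OffAnnouncementLocusX8`).
* Sprung 2012 Thm 7.16 (Kato): the OTHER inclusion, up to `3ⁿ` — typed, not this half.
* a_p = 0 results (Kobayashi 2003, Pollack, Wan 2015 ±, BSTW 2024) — a₃ = ±3 is a_p ≠ 0: not applicable.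
* Sprung 2024 (Adv. Math. 449, 109741) Thm 1.1: ♯/♭ MC for square-free `N` GIVEN his Conj. 3.33 —
  conditional; tree: `Sprung2024.*` carries only §5 (rank 0/1 one-sided, of Kato).
* Castella–Çiperiani–Skinner–Sprung 2018 Thms C/D (`CastellaCiperianiSkinnerSprung2018.thmCD_pPart_OPEN`):
  unrefereed, semistable + no `p`-isogeny, rests on Wan's two-variable non-ordinary MC.
* Fouquet–Wan 2021 Thm 5.1 / Cor 5.4 (`FouquetWan2021.thm51_etaKatoMC_OPEN`, `cor54_pPart_rankZero_OPEN`):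
  unrefereed; needs a ramified multiplicative prime `ℓ`; non-ordinary Eisenstein side rests on withdrawn Wan 2015.
So the unconditional printed lower bound at `(3, a₃ = ±3)` is EMPTY: the residual class of the crux is all of X8
(217 census cells), with no sub-locus settled. A disproof would be a counterexample to MC 7.21 itself.

## HANDOFF
* landed under `Theorems/SprungLowerDivisibilityAtThree/Negative/`: see NOTES.md (proposal ids).
* sorried here: nothing.
* next regimes for a re-armed seat: (i) if a line is picked, attack its stubs (drop `IsCyclotomicVariable` /
  `IsTopGenerator g` / Honda generation clauses one at a time; joint sufficiency of `…_of`); (ii) the planner-facing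
  remark that the route's glue (`chromaticDivisibility_of_sharpFlatLowerDivisibility_of_thm714`) consumes only
  `∃ •` and only the Euler-characteristic (`T = 0`) shadow in analytic rank 0 — the crux (∀ •, full `Λ`-divisibility)
  is far stronger than needed; a counterexample to the crux need not touch the route's use, nor the summit.
* NOT necessary for the summit: unlike `SelmerRankLB`, `¬ crux` would not refute `BirchSwinnertonDyer` (MC 7.21 is
  tower-wide); so no "counterexample to the crux = counterexample to BSD" transfer is available either.
-/

set_option autoImplicit false
-- the problem directory `BirchSwinnertonDyer/BirchSwinnertonDyer` forces the duplicated namespace segment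
set_option linter.dupNamespace false

noncomputable section

open scoped Classical NumberField MatrixGroups ModularForm

open NumberField IsDedekindDomain CongruenceSubgroup WeierstrassCurve
  Literature.NumberTheory.EllipticCurves Literature.NumberTheory.EllipticCurves.ModularForms
  Literature.NumberTheory.EllipticCurves.ZpExtension Literature.NumberTheory.EllipticCurves.Sprung2017
  Literature.NumberTheory.EllipticCurves.Sprung2012 Literature.NumberTheory.EllipticCurves.Rank1Residual

namespace Summit.BirchSwinnertonDyer.BirchSwinnertonDyer.Cruxes.SprungLowerDivisibilityAtThree.Disproof

universe u

variable {p : ℕ} [Fact p.Prime]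

/-! ## (a) Load-bearing hypothesis 1: the guard `L^• ≠ 0` -/

/-- The conclusion shape of `SprungSharpFlatLowerDivisibility`: "`I = (gen)` with `ι gen = ϖ · ι(L · h)`". -/
def LowerShape (ϖ : ℚ_[p]) (L : IwasawaAlgebra p) (I : Ideal (IwasawaAlgebra p)) : Prop :=
  ∃ gen h : IwasawaAlgebra p, I = Ideal.span {gen} ∧
    iwasawaToPowerSeries p gen = PowerSeries.C ϖ * iwasawaToPowerSeries p (L * h)

/-- At `L = 0` the lower-divisibility shape forces `I = ⊥`; so it is unsatisfiable for any nonzero ideal.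
[folklore] -/
theorem not_lowerShape_zero {ϖ : ℚ_[p]} {I : Ideal (IwasawaAlgebra p)} (hI : I ≠ ⊥) :
    ¬ LowerShape ϖ 0 I := by
  rintro ⟨gen, h, hI', hι⟩
  rw [zero_mul, map_zero, mul_zero] at hι
  have hgen : gen = 0 := iwasawaToPowerSeries_injective p (by rw [hι, map_zero])
  exact hI (by rw [hI', hgen, Ideal.span_singleton_eq_bot])

/-- **The guard is load-bearing.** For EVERY dual datum `D` of `Sel^•(E/K_∞)` and every `ϖ`, the conclusion of
`SprungSharpFlatLowerDivisibility` with `L^• = 0` is FALSE: `char_Λ(D.X) ≠ ⊥` (`Module.charIdeal_ne_bot`) while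
`ι gen = ϖ · ι(0 · h) = 0` forces `gen = 0`. Hence the displayed hypothesis `chromaticL • L♯ L♭ ≠ 0` cannot be
dropped unless `L^•` never vanishes (Sprung 2017 Conj. 4.12, open). [folklore] -/
theorem lowerDivisibility_conclusion_false_of_chromaticL_eq_zero {K : Type u} [Field K] [NumberField K]
    {W : WeierstrassCurve K} {κ : ZpExtension K p} {γ : Field.absoluteGaloisGroup K}
    {E : Type u} [Field E] [Algebra K E] {ι : AlgebraicClosure K →ₐ[K] AlgebraicClosure E} {ap : ℤ}
    {g : Field.absoluteGaloisGroup E} {c : ℕ → localPoints W E} {col : Chroma}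
    (D : SharpFlatSelmerDualData W κ γ ι ap g c col) (ϖ : ℚ_[p]) {Lsharp Lflat : IwasawaAlgebra p}
    (h0 : chromaticL col Lsharp Lflat = 0) :
    ¬ ∃ gen h : IwasawaAlgebra p, D.charIdeal = Ideal.span {gen} ∧
      iwasawaToPowerSeries p gen = PowerSeries.C ϖ * iwasawaToPowerSeries p (chromaticL col Lsharp Lflat * h) := by
  rw [h0]
  exact not_lowerShape_zero (Module.charIdeal_ne_bot (IwasawaAlgebra p) D.X)

/-- `SprungSharpFlatLowerDivisibility W p •` with the guard `chromaticL • L♯ L♭ ≠ 0` DROPPED (all other binders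
verbatim). -/
def SprungSharpFlatLowerDivisibilityWithoutGuard (W : WeierstrassCurve ℚ) [W.IsElliptic]
    [W.IsGloballyMinimal] (p : ℕ) [Fact p.Prime] (col : Chroma) : Prop :=
  ∀ (κ : ZpExtension ℚ p) (γ : Field.absoluteGaloisGroup ℚ),
      κ.IsCyclotomic → κ.IsTopGenerator γ → IsCyclotomicVariable p γ →
    ∀ (v : HeightOneSpectrum (𝓞 ℚ)), (p : 𝓞 ℚ) ∈ v.asIdeal →
    ∀ (g : Field.absoluteGaloisGroup (v.adicCompletion ℚ)),
      κ.IsTopGenerator (resGalOfEmb (closureEmb (K := ℚ) (v.adicCompletion ℚ)) g) →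
    ∀ (cneg : localPoints W (v.adicCompletion ℚ)) (c : ℕ → localPoints W (v.adicCompletion ℚ)),
      IsHondaSystem κ (closureEmb (K := ℚ) (v.adicCompletion ℚ)) W (W.frobeniusTrace p) g cneg c →
    ∀ (N : ℕ) (_ : NeZero N) (f : CuspForm (Gamma0 N) 2) (ϖ : ℚ) (Lsharp Lflat : IwasawaAlgebra p),
      IsNewformOf W f → (ϖ : ℝ) * W.realPeriodRat = plusPeriod f →
      IsSprungPair f p (W.frobeniusTrace p) Lsharp Lflat →
    ∀ D : SharpFlatSelmerDualData W κ γ (closureEmb (K := ℚ) (v.adicCompletion ℚ))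
        (W.frobeniusTrace p) g c col,
      ∃ gen h : IwasawaAlgebra p, D.charIdeal = Ideal.span {gen} ∧
        iwasawaToPowerSeries p gen =
          PowerSeries.C (ϖ : ℚ_[p]) * iwasawaToPowerSeries p (chromaticL col Lsharp Lflat * h)

/-- **Dropping the guard adds Sprung 2017 Conj. 4.12.** The guard-free lower divisibility implies, for every
admissible data tuple (cyclotomic `(κ, γ)`, place, lift, Honda system, newform, period ratio, Sprung pair), that
`L^•` is NOT identically zero — the dual datum exists unconditionally (`nonempty_sharpFlatSelmerDualData_rat`), and
at `L^• = 0` the conclusion is false (`lowerDivisibility_conclusion_false_of_chromaticL_eq_zero`). So "any proof must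
use the guard", short of proving Conj. 4.12 for X8 curves. [cite: Sprung2017, Conj. 4.12] -/
theorem chromaticL_ne_zero_of_withoutGuard (W : WeierstrassCurve ℚ) [W.IsElliptic] [W.IsGloballyMinimal]
    (p : ℕ) [Fact p.Prime] (col : Chroma) (hW : SprungSharpFlatLowerDivisibilityWithoutGuard W p col)
    (κ : ZpExtension ℚ p) (γ : Field.absoluteGaloisGroup ℚ) (hκ : κ.IsCyclotomic) (hγ : κ.IsTopGenerator γ)
    (hvar : IsCyclotomicVariable p γ) (v : HeightOneSpectrum (𝓞 ℚ)) (hv : (p : 𝓞 ℚ) ∈ v.asIdeal)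
    (g : Field.absoluteGaloisGroup (v.adicCompletion ℚ))
    (hg : κ.IsTopGenerator (resGalOfEmb (closureEmb (K := ℚ) (v.adicCompletion ℚ)) g))
    (cneg : localPoints W (v.adicCompletion ℚ)) (c : ℕ → localPoints W (v.adicCompletion ℚ))
    (hc : IsHondaSystem κ (closureEmb (K := ℚ) (v.adicCompletion ℚ)) W (W.frobeniusTrace p) g cneg c)
    (N : ℕ) (hN : NeZero N) (f : CuspForm (Gamma0 N) 2) (ϖ : ℚ) (Lsharp Lflat : IwasawaAlgebra p)
    (hf : IsNewformOf W f) (hϖ : (ϖ : ℝ) * W.realPeriodRat = plusPeriod f)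
    (hL : IsSprungPair f p (W.frobeniusTrace p) Lsharp Lflat) :
    chromaticL col Lsharp Lflat ≠ 0 := by
  intro h0
  obtain ⟨D⟩ := nonempty_sharpFlatSelmerDualData_rat W κ γ v g c col
  exact lowerDivisibility_conclusion_false_of_chromaticL_eq_zero D (ϖ : ℚ_[p]) h0
    (hW κ γ hκ hγ hvar v hv g hg cneg c hc N hN f ϖ Lsharp Lflat hf hϖ hL D)

/-- Conversely the guard is the ONLY difference: the crux's leaf plus non-vanishing gives the guard-free form.
[folklore] -/
theorem withoutGuard_of_lowerDivisibility_of_ne_zero (W : WeierstrassCurve ℚ) [W.IsElliptic]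
    [W.IsGloballyMinimal] (p : ℕ) [Fact p.Prime] (col : Chroma)
    (h : Theorems.SprungSharpFlatLowerDivisibility W p col)
    (hnv : ∀ (N : ℕ) (_ : NeZero N) (f : CuspForm (Gamma0 N) 2) (Lsharp Lflat : IwasawaAlgebra p),
      IsNewformOf W f → IsSprungPair f p (W.frobeniusTrace p) Lsharp Lflat → chromaticL col Lsharp Lflat ≠ 0) :
    SprungSharpFlatLowerDivisibilityWithoutGuard W p col :=
  fun κ γ hκ hγ hvar v hv g hg cneg c hc N hN f ϖ Lsharp Lflat hf hϖ hL D ↦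
    h κ γ hκ hγ hvar v hv g hg cneg c hc N hN f ϖ Lsharp Lflat hf hϖ hL (hnv N hN f Lsharp Lflat hf hL) D

/-! ## (a) Load-bearing content 2: torsion is smuggled in by the junk convention `char(non-torsion) = ⊤` -/

/-- **Torsion smuggling, vanishing constant term.** If `char_Λ(X) = (gen)` with `ι gen = ϖ · ι(L · h)` and
`L(0) = 0`, then `X` is `Λ`-torsion: otherwise `char_Λ(X) = ⊤` (`Theorems.charIdeal_eq_top_of_not_isTorsion`),
`gen` is a unit, but `gen(0) = ϖ · L(0) · h(0) = 0`. [folklore] -/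
theorem isTorsion_of_charIdeal_eq_span_of_constantCoeff_eq_zero (X : Type*) [AddCommGroup X]
    [Module (IwasawaAlgebra p) X] {gen L h : IwasawaAlgebra p} {ϖ : ℚ_[p]}
    (hI : Module.charIdeal (IwasawaAlgebra p) X = Ideal.span {gen})
    (hι : iwasawaToPowerSeries p gen = PowerSeries.C ϖ * iwasawaToPowerSeries p (L * h))
    (hL0 : PowerSeries.constantCoeff L = 0) :
    Module.IsTorsion (IwasawaAlgebra p) X := by
  by_contra hX
  have htop := Theorems.charIdeal_eq_top_of_not_isTorsion (p := p) X hX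
  rw [hI, Ideal.span_singleton_eq_top] at htop
  have hunit : IsUnit (PowerSeries.constantCoeff gen) := PowerSeries.isUnit_constantCoeff gen htop
  have h0 : ((PowerSeries.constantCoeff gen : ℤ_[p]) : ℚ_[p]) = 0 := by
    have := congrArg PowerSeries.constantCoeff hι
    simpa [map_mul, constantCoeff_iwasawaToPowerSeries, hL0] using this
  rw [PadicInt.coe_eq_zero] at h0
  rw [h0] at hunit
  exact not_isUnit_zero hunit

/-- **Torsion smuggling, general form.** If `char_Λ(X) = (gen)` with `ι gen = ϖ · ι(L · h)`, `ϖ` `p`-integral and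
`L` a NON-unit of `Λ` (i.e. `p ∣ L(0)`), then `X` is `Λ`-torsion. So for `ϖ ∈ ℤ_(p)` the typed lower divisibility
is equivalent to "(L unit) ∨ (X torsion ∧ ϖ·L ∣ char X)". [folklore] -/
theorem isTorsion_of_charIdeal_eq_span_of_not_isUnit (X : Type*) [AddCommGroup X]
    [Module (IwasawaAlgebra p) X] {gen L h : IwasawaAlgebra p} {ϖ : ℚ_[p]}
    (hI : Module.charIdeal (IwasawaAlgebra p) X = Ideal.span {gen})
    (hι : iwasawaToPowerSeries p gen = PowerSeries.C ϖ * iwasawaToPowerSeries p (L * h))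
    (hϖ : ‖ϖ‖ ≤ 1) (hL : ¬ IsUnit L) :
    Module.IsTorsion (IwasawaAlgebra p) X := by
  by_contra hX
  have htop := Theorems.charIdeal_eq_top_of_not_isTorsion (p := p) X hX
  rw [hI, Ideal.span_singleton_eq_top] at htop
  have hx : ‖(PowerSeries.constantCoeff gen : ℤ_[p])‖ = 1 :=
    PadicInt.isUnit_iff.mp (PowerSeries.isUnit_constantCoeff gen htop)
  have hc : ((PowerSeries.constantCoeff gen : ℤ_[p]) : ℚ_[p]) =
      ϖ * (((PowerSeries.constantCoeff L : ℤ_[p]) : ℚ_[p]) * ((PowerSeries.constantCoeff h : ℤ_[p]) : ℚ_[p])) := by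
    have := congrArg PowerSeries.constantCoeff hι
    simpa [map_mul, constantCoeff_iwasawaToPowerSeries] using this
  have hn : (1 : ℝ) = ‖ϖ‖ * (‖(PowerSeries.constantCoeff L : ℤ_[p])‖ * ‖(PowerSeries.constantCoeff h : ℤ_[p])‖) := by
    rw [← hx, ← PadicInt.padic_norm_e_of_padicInt, hc, norm_mul, norm_mul, PadicInt.padic_norm_e_of_padicInt,
      PadicInt.padic_norm_e_of_padicInt]
  have hL1 : ‖(PowerSeries.constantCoeff L : ℤ_[p])‖ < 1 := by
    rcases (PadicInt.norm_le_one (PowerSeries.constantCoeff L : ℤ_[p])).lt_or_eq with hlt | heq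
    · exact hlt
    · exact absurd (PowerSeries.isUnit_iff_constantCoeff.mpr (PadicInt.isUnit_iff.mpr heq)) hL
  have hh1 : ‖(PowerSeries.constantCoeff h : ℤ_[p])‖ ≤ 1 := PadicInt.norm_le_one _
  set a := ‖ϖ‖ with ha
  set b := ‖(PowerSeries.constantCoeff L : ℤ_[p])‖ with hb
  set d := ‖(PowerSeries.constantCoeff h : ℤ_[p])‖ with hd
  have ha0 : 0 ≤ a := norm_nonneg _
  have hb0 : 0 ≤ b := norm_nonneg _
  have hd0 : 0 ≤ d := norm_nonneg _
  nlinarith [mul_nonneg (sub_nonneg.mpr hϖ) (mul_nonneg hb0 hd0), mul_nonneg (sub_nonneg.mpr hh1) hb0]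

/-- **The crux contains Thm 7.14 at every analytic zero.** `SprungLowerDivisibilityAtThree` implies: for every
X8 pair, every admissible data tuple and every dual datum `D`, if `L^•(0) = 0` (e.g. `L(E,1) = 0`, since
`L^•(0) = c_• · L(E,1)/Ω⁺`) then `X^•(E/ℚ_∞) = D.X` is `Λ`-torsion — the content of Sprung 2012 Thm 7.14 (Kato),
which a reader of "lower half" would not expect the statement to assert. (The typed leaf is therefore
"Thm 7.14-at-non-units ∧ printed Eisenstein half"; the extra conjunct is dischargeable by the typed fact
`Sprung2012.thm714_sharpFlatSelmerDual_finite_torsion`, so this is a proof obligation, not a misstatement.)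
[cite: Sprung2012, Thm. 7.14 (p. 1504)] -/
theorem isTorsion_of_sprungLowerDivisibilityAtThree
    (hcrux : Theses.SignedLowerHalves.SprungLowerDivisibilityAtThree)
    (W : WeierstrassCurve ℚ) [W.IsElliptic] [W.IsGloballyMinimal] (p : ℕ) [Fact p.Prime]
    (hX8 : ClassX8 W p) (col : Chroma)
    (κ : ZpExtension ℚ p) (γ : Field.absoluteGaloisGroup ℚ) (hκ : κ.IsCyclotomic) (hγ : κ.IsTopGenerator γ)
    (hvar : IsCyclotomicVariable p γ) (v : HeightOneSpectrum (𝓞 ℚ)) (hv : (p : 𝓞 ℚ) ∈ v.asIdeal)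
    (g : Field.absoluteGaloisGroup (v.adicCompletion ℚ))
    (hg : κ.IsTopGenerator (resGalOfEmb (closureEmb (K := ℚ) (v.adicCompletion ℚ)) g))
    (cneg : localPoints W (v.adicCompletion ℚ)) (c : ℕ → localPoints W (v.adicCompletion ℚ))
    (hc : IsHondaSystem κ (closureEmb (K := ℚ) (v.adicCompletion ℚ)) W (W.frobeniusTrace p) g cneg c)
    (N : ℕ) (hN : NeZero N) (f : CuspForm (Gamma0 N) 2) (ϖ : ℚ) (Lsharp Lflat : IwasawaAlgebra p)
    (hf : IsNewformOf W f) (hϖ : (ϖ : ℝ) * W.realPeriodRat = plusPeriod f)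
    (hL : IsSprungPair f p (W.frobeniusTrace p) Lsharp Lflat) (hne : chromaticL col Lsharp Lflat ≠ 0)
    (D : SharpFlatSelmerDualData W κ γ (closureEmb (K := ℚ) (v.adicCompletion ℚ)) (W.frobeniusTrace p) g c col)
    (h0 : PowerSeries.constantCoeff (chromaticL col Lsharp Lflat) = 0) :
    Module.IsTorsion (IwasawaAlgebra p) D.X := by
  obtain ⟨gen, h, hI, hι⟩ :=
    hcrux W p hX8 col κ γ hκ hγ hvar v hv g hg cneg c hc N hN f ϖ Lsharp Lflat hf hϖ hL hne D
  exact isTorsion_of_charIdeal_eq_span_of_constantCoeff_eq_zero D.X hI hι h0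

/-! ## (b) Boundary facts: the chromatic constants at X8 never vanish (no forced trivial zero of `L^•(0)`) -/

/-- `(c_♯, c_♭)(a₃ = 3) = (−1, −1)` and `(c_♯, c_♭)(a₃ = −3) = (−13, 5)` in the tree's normalisation
(`Sprung2017.chromaticConst`): `3`-adic units, no forced zero of `L^•(0)` at X8. -/
example : chromaticConst 3 3 .sharp = -1 ∧ chromaticConst 3 3 .flat = -1 ∧
    chromaticConst 3 (-3) .sharp = -13 ∧ chromaticConst 3 (-3) .flat = 5 := by
  decide

/-! ## (c) What print excludes — typed (D-0131 class #6)

No UNCONDITIONAL published theorem yields `SprungSharpFlatLowerDivisibility W 3 •` at any X8 pair: the printed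
unconditional locus is EMPTY and the crux's residual class is all of X8. The Λ-adic statements in circulation and
their hypothesis sets at `(3, a₃ = ±3)`:
* [Sp24] Sprung, Adv. Math. 449 (2024) Thm 1.1: `N` square-free — CONDITIONAL on his Conj. 3.33 (Beilinson–Flach,
  not typeable today) and on CLW22 Thm 8.2.1 at `ξ = 𝟙` (tree: `BurungaleSkinnerTianWan2024.thm924_…_OPEN`);
* [CCSS18] arXiv:1804.10993 (unrefereed; rests on withdrawn arXiv:1411.6352): semistable, no `3`-isogeny
  (tree: `CastellaCiperianiSkinnerSprung2018.thmCD_pPart_OPEN`, the `T = 0` shadow only);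
* [FW21] arXiv:2107.13726 Thm 5.1 / 4.51 (unrefereed; non-ordinary Eisenstein side over Wan): `E[3]` irreducible +
  a non-split multiplicative prime `ℓ ≠ 3` with `3 ∤ ord_ℓ Δ_min` (tree: `FouquetWan2021.thm51_etaKatoMC_OPEN`,
  `cor54_pPart_rankZero_OPEN`);
* not reaching X8 at all: every `a_p = 0` result (Kobayashi 03, Pollack 03, Wan ±, BSTW24 — `ClassX8.not_bstw_h4`),
  CW24 / BLV26 (`p ≥ 5`), CHKLL23 (bipartite; `NoAdmissiblePrimesAtThree`), CL25 congruence transfer (preprint).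
`AnnouncedLocusX8` below is the union of the hypothesis sets of [Sp24] ∪ [CCSS18] ∪ [FW21] read at an X8 pair
(`Irr W 3` is automatic at supersingular `3` but printed); `OffAnnouncementLocusX8` is its complement inside X8 —
the pairs on which not even a conditional theorem or an unrefereed preprint asserts the crux: additive reduction
somewhere AND no ramified non-split multiplicative prime (e.g. every X8 curve with `N` a perfect square or cube-full
outside `3`). Numerically (dossier §4): the finitely checkable shadow (L′) `ord₃ #Ш_an ≤ ord₃ #Ш[3^∞]` and the
`μ`-side (`μ(θ_n) = 0` at `n = 3,4,5` on 61/61 small-image cells, `PrintX8/CertificateMazurTateRecordsA–D`) show no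
witness against the crux anywhere in the 217-cell census; a `μ`-witness would also contradict Perrin-Riou's `μ = 0`
conjecture. -/

/-- **The announced locus inside X8**: hypothesis sets of Sprung 2024 Thm 1.1 (square-free `N` ⊆ semistable; given
Conj. 3.33), CCSS 2018 Thms B–D (semistable, `E[3]` irreducible, no `3`-isogeny — the last two automatic at a
supersingular `3`) and Fouquet–Wan 2021 Thm 5.1 (`E[3]` irreducible and a non-split multiplicative `ℓ ≠ 3` at which
`E[3]` is ramified, `3 ∤ ord_ℓ(Δ_min)`), read at `p = 3`. Nothing here is an unconditional published theorem.
[cite: Sprung2024, Thm. 1.1] [claim: CastellaCiperianiSkinnerSprung2018, status: under-review]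
[claim: FouquetWan2021, status: under-review] -/
def AnnouncedLocusX8 (W : WeierstrassCurve ℚ) [W.IsElliptic] [W.IsGloballyMinimal] : Prop :=
  Semistable W ∨
  (Irr W 3 ∧ ∃ (ℓ : ℕ) (_ : Fact ℓ.Prime), ℓ ≠ 3 ∧ W.HasMultiplicativeReductionAtPrime ℓ ∧
      ¬ W.HasSplitMultiplicativeReductionAtPrime ℓ ∧ ¬ (3 : ℕ) ∣ (padicValInt ℓ W.minimalDiscriminantInt))

/-- **The residual of the residual**: X8 pairs off every announcement — not semistable (additive reduction at some
prime) and no ramified non-split multiplicative prime away from `3`. On this locus the crux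
`SprungSharpFlatLowerDivisibility W 3 •` is asserted by no theorem, no conditional theorem and no preprint.
[cite: Sprung2024, Thm. 1.1] -/
def OffAnnouncementLocusX8 (W : WeierstrassCurve ℚ) [W.IsElliptic] [W.IsGloballyMinimal] : Prop :=
  ClassX8 W 3 ∧ ¬ AnnouncedLocusX8 W

/-- Membership test for the off-announcement locus from the two printed exclusions: an X8 curve with a prime of
additive reduction (`hadd : ¬ Semistable W`) all of whose multiplicative primes `ℓ ≠ 3` are split or have
`3 ∣ ord_ℓ Δ_min` lies off every announcement. [folklore] -/
theorem offAnnouncementLocusX8_of_not_semistable (W : WeierstrassCurve ℚ) [W.IsElliptic] [W.IsGloballyMinimal]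
    (hX8 : ClassX8 W 3) (hadd : ¬ Semistable W)
    (hmult : ∀ (ℓ : ℕ) (_ : Fact ℓ.Prime), ℓ ≠ 3 → W.HasMultiplicativeReductionAtPrime ℓ →
      W.HasSplitMultiplicativeReductionAtPrime ℓ ∨ (3 : ℕ) ∣ padicValInt ℓ W.minimalDiscriminantInt) :
    OffAnnouncementLocusX8 W := by
  refine ⟨hX8, ?_⟩
  rintro (hss | ⟨-, ℓ, hℓ, hℓ3, hm, hns, hnd⟩)
  · exact hadd hss
  · rcases hmult ℓ hℓ hℓ3 hm with hs | hd
    · exact hns hs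
    · exact hnd hd

end Summit.BirchSwinnertonDyer.BirchSwinnertonDyer.Cruxes.SprungLowerDivisibilityAtThree.Disproof

end
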